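import Mathlib
import Summits.MatrixMultiplication.MatrixMultiplication.Theorems.SoloBlindFlatCorankOne
import Summits.MatrixMultiplication.MatrixMultiplication.Theorems.SoloBlindLift

/-!
# Conjecture E♭ — statement and the corank-one case (every rank)

Sub-programme (K₃) / Conjecture E.  CONJECTURE E♭ (K3.29 (iv)): for `h` zero-sum free on `S` and an H-good target `τ`
(`∑_T h ≠ τ + τ` for all `T ⊆ S`), with core rank `ρ` and core size `c` (`soloBlindCore`, `soloBlindCoreRank`),

  `E(τ; S) ≤ 1/2 + 2^{-ρ} - 2^{ρ-1-c}`      (`soloBlindEFlatBound ρ c` of `SoloBlindLift`; `soloBlindEFlatAt h S τ`);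

since `c ≤ 2ρ - 1` for H-good `τ` this refines Conjecture E (`E ≤ 1/2`).  This file states it and proves:

* `soloBlind_eflat_of_card_le_one` — E♭ whenever the H-good `τ` has at most one representation (any `S`; corank zero);
* `soloBlind_corankOne_reps` — on `S = B ∪ {p}` with `B` subset-sum distinct, either `τ` has at most one representation or exactly the
  two representations `A` and `A' ∪ {p}` (`A, A' ⊆ B`);
* `soloBlind_eflat_corank_one` — E♭ AT CORANK ONE in every rank: H-goodness forces `A ∩ A' ≠ ∅` (else `A ∪ A' ∪ {p}` represents
  `τ + τ`), zero-sum freeness forces `A ⊄ A'`, so `|A| ≥ 2`, `|A'| ≥ 1`, `|A ∪ A'| ≤ |A| + |A'| - 1`, the core rank is at most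
  `|A ∪ A'| = c - 1`, and the inequality `2^{-a} + 2^{-a'-1} ≤ 1/4 + 2^{-(a+a'-1)}` is `(1 - 2^{2-a})(1 - 2^{1-a'}) ≥ 0`.
-/

namespace Summit.MatrixMultiplication.MatrixMultiplication.Theorems

open Finset

universe u

variable {ι : Type*} [DecidableEq ι]
variable {G : Type u} [AddCommGroup G] [DecidableEq G]

/-- CONJECTURE E♭ at `(h, S, τ)`: `E(τ; S) ≤ 1/2 + 2^{-ρ} - 2^{ρ-1-c}`.  (Conjectured for every `h` zero-sum free on `S` in a
`ZMod 3`-module and every H-good `τ`; open.) -/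
def soloBlindEFlatAt [Module (ZMod 3) G] (h : ι → G) (S : Finset ι) (τ : G) : Prop :=
  soloBlindMass h S τ ≤ soloBlindEFlatBound (soloBlindCoreRank h S τ) (soloBlindCore h S τ).card

/-- `2^{-c} ≤ 1/2 + 2^{-ρ} - 2^{ρ-1-c}` for `ρ ≤ c`. -/
theorem soloBlind_pow_le_eflatBound {ρ c : ℕ} (h : ρ ≤ c) : (1 / 2 : ℚ) ^ c ≤ soloBlindEFlatBound ρ c := by
  unfold soloBlindEFlatBound
  have h1 : (1 / 2 : ℚ) ^ (c + 1 - ρ) ≤ 1 / 2 := by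
    calc (1 / 2 : ℚ) ^ (c + 1 - ρ) ≤ (1 / 2 : ℚ) ^ 1 := pow_le_pow_of_le_one (by norm_num) (by norm_num) (by omega)
      _ = 1 / 2 := pow_one _
  have h2 : (1 / 2 : ℚ) ^ c ≤ (1 / 2 : ℚ) ^ ρ := pow_le_pow_of_le_one (by norm_num) (by norm_num) h
  linarith

/-- The bound is non-negative (`ρ ≤ c`). -/
theorem soloBlind_eflatBound_nonneg {ρ c : ℕ} (h : ρ ≤ c) : 0 ≤ soloBlindEFlatBound ρ c :=
  (by positivity : (0 : ℚ) ≤ (1 / 2 : ℚ) ^ c).trans (soloBlind_pow_le_eflatBound h)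

/-- The bound decreases in `ρ` (`ρ ≤ ρ' ≤ c`). -/
theorem soloBlind_eflatBound_anti {ρ ρ' c : ℕ} (h : ρ ≤ ρ') (hc : ρ' ≤ c) :
    soloBlindEFlatBound ρ' c ≤ soloBlindEFlatBound ρ c := by
  unfold soloBlindEFlatBound
  have h1 : (1 / 2 : ℚ) ^ ρ' ≤ (1 / 2 : ℚ) ^ ρ := pow_le_pow_of_le_one (by norm_num) (by norm_num) h
  have h2 : (1 / 2 : ℚ) ^ (c + 1 - ρ) ≤ (1 / 2 : ℚ) ^ (c + 1 - ρ') :=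
    pow_le_pow_of_le_one (by norm_num) (by norm_num) (by omega)
  linarith

/-- The bound is at most `1/2` when `c ≤ 2ρ - 1`. -/
theorem soloBlind_eflatBound_le_half {ρ c : ℕ} (hc : c + 1 ≤ 2 * ρ) : soloBlindEFlatBound ρ c ≤ 1 / 2 := by
  unfold soloBlindEFlatBound
  have h1 : (1 / 2 : ℚ) ^ ρ ≤ (1 / 2 : ℚ) ^ (c + 1 - ρ) :=
    pow_le_pow_of_le_one (by norm_num) (by norm_num) (by omega)
  linarith

/-- E♭ WITH AT MOST ONE REPRESENTATION (any `S`). -/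
theorem soloBlind_eflat_of_card_le_one [Module (ZMod 3) G] {h : ι → G} {S : Finset ι} {τ : G}
    (hR : (soloBlindSeqRepAll h S τ).card ≤ 1) : soloBlindEFlatAt h S τ := by
  unfold soloBlindEFlatAt
  have hρ := soloBlind_coreRank_le_card h S τ
  by_cases hempty : soloBlindSeqRepAll h S τ = ∅
  · have h0 : soloBlindMass h S τ = 0 := by rw [soloBlindMass, hempty, Finset.sum_empty]
    rw [h0]
    exact soloBlind_eflatBound_nonneg hρ
  · obtain ⟨T, hT⟩ := Finset.nonempty_iff_ne_empty.2 hempty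
    have hcore := soloBlind_core_of_card_le_one hR hT
    have hmass : soloBlindMass h S τ ≤ (1 / 2 : ℚ) ^ T.card :=
      soloBlind_mass_le_pow_of_card_le_one h S τ T.card hR
        (fun T' hT' => by rw [Finset.card_le_one.1 hR T' hT' T hT])
    rw [hcore] at hρ ⊢
    exact hmass.trans (soloBlind_pow_le_eflatBound hρ)

/-- STRUCTURE AT CORANK ONE: on `S = B ∪ {p}` (`B` subset-sum distinct, `p ∉ B`) a target has at most one representation, or
exactly the two representations `A` and `A' ∪ {p}` with `A, A' ⊆ B`, `∑_A h = τ`, `∑_{A'} h = τ - h p`. -/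
theorem soloBlind_corankOne_reps {h : ι → G} {B : Finset ι} {p : ι} (hpB : p ∉ B)
    (hdist : ∀ A ⊆ B, ∀ A' ⊆ B, ∑ i ∈ A, h i = ∑ i ∈ A', h i → A = A') (τ : G) :
    (soloBlindSeqRepAll h (insert p B) τ).card ≤ 1 ∨
      ∃ A A' : Finset ι, A ⊆ B ∧ A' ⊆ B ∧ ∑ i ∈ A, h i = τ ∧ ∑ i ∈ A', h i = τ - h p ∧
        soloBlindSeqRepAll h (insert p B) τ = {A, insert p A'} := by
  classical
  have hR1 : (soloBlindSeqRepAll h B τ).card ≤ 1 := soloBlind_repAll_card_le_one_of_sumDistinct hdist τ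
  have hR'1 : (soloBlindSeqRepAll h B (τ - h p)).card ≤ 1 :=
    soloBlind_repAll_card_le_one_of_sumDistinct hdist (τ - h p)
  by_cases hA : (soloBlindSeqRepAll h B τ).Nonempty
  swap
  · rw [Finset.not_nonempty_iff_eq_empty] at hA
    left
    refine Finset.card_le_one.2 (fun T₁ hT₁ T₂ hT₂ => ?_)
    have hp1 : p ∈ T₁ := by
      by_contra hp; have := (soloBlind_repAll_insert_cases hT₁).1 hp; rw [hA] at this; simp at this
    have hp2 : p ∈ T₂ := by
      by_contra hp; have := (soloBlind_repAll_insert_cases hT₂).1 hp; rw [hA] at this; simp at this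
    have e := Finset.card_le_one.1 hR'1 _ ((soloBlind_repAll_insert_cases hT₁).2 hp1) _
      ((soloBlind_repAll_insert_cases hT₂).2 hp2)
    rw [← Finset.insert_erase hp1, ← Finset.insert_erase hp2, e]
  by_cases hA' : (soloBlindSeqRepAll h B (τ - h p)).Nonempty
  swap
  · rw [Finset.not_nonempty_iff_eq_empty] at hA'
    left
    refine Finset.card_le_one.2 (fun T₁ hT₁ T₂ hT₂ => ?_)
    have hp1 : p ∉ T₁ := by
      intro hp; have := (soloBlind_repAll_insert_cases hT₁).2 hp; rw [hA'] at this; simp at this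
    have hp2 : p ∉ T₂ := by
      intro hp; have := (soloBlind_repAll_insert_cases hT₂).2 hp; rw [hA'] at this; simp at this
    exact Finset.card_le_one.1 hR1 _ ((soloBlind_repAll_insert_cases hT₁).1 hp1) _
      ((soloBlind_repAll_insert_cases hT₂).1 hp2)
  right
  obtain ⟨A, hAm⟩ := hA
  obtain ⟨A', hA'm⟩ := hA'
  obtain ⟨hAB, hAs⟩ := soloBlind_mem_seqRepAll.1 hAm
  obtain ⟨hA'B, hA's⟩ := soloBlind_mem_seqRepAll.1 hA'm
  have hpA' : p ∉ A' := fun hp => hpB (hA'B hp)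
  refine ⟨A, A', hAB, hA'B, hAs, hA's, ?_⟩
  have hT₂m : insert p A' ∈ soloBlindSeqRepAll h (insert p B) τ := by
    refine soloBlind_mem_seqRepAll.2 ⟨Finset.insert_subset_insert p hA'B, ?_⟩
    rw [Finset.sum_insert hpA', hA's]
    abel
  have hAm' : A ∈ soloBlindSeqRepAll h (insert p B) τ :=
    soloBlind_mem_seqRepAll.2 ⟨hAB.trans (Finset.subset_insert p B), hAs⟩
  ext T
  rw [Finset.mem_insert, Finset.mem_singleton]
  constructor
  · intro hT
    by_cases hp : p ∈ T
    · right
      have e := Finset.card_le_one.1 hR'1 _ ((soloBlind_repAll_insert_cases hT).2 hp) _ hA'm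
      rw [← Finset.insert_erase hp, e]
    · left
      exact Finset.card_le_one.1 hR1 _ ((soloBlind_repAll_insert_cases hT).1 hp) _ hAm
  · rintro (rfl | rfl)
    · exact hAm'
    · exact hT₂m

/-- The two-representation inequality of E♭: `2^{-a} + 2^{-a'-1} ≤ 1/4 + 2^{-u}` for `a ≥ 2`, `a' ≥ 1`, `u + 1 ≤ a + a'`
(it is `(1 - 2^{2-a}) (1 - 2^{1-a'}) ≥ 0` at `u = a + a' - 1`). -/
theorem soloBlind_twoRep_ineq_E {a a' u : ℕ} (ha : 2 ≤ a) (ha' : 1 ≤ a') (hu : u + 1 ≤ a + a') :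
    (1 / 2 : ℚ) ^ a + (1 / 2 : ℚ) ^ (a' + 1) ≤ 1 / 4 + (1 / 2 : ℚ) ^ u := by
  obtain ⟨a₀, rfl⟩ := Nat.exists_eq_add_of_le ha
  obtain ⟨a₁, rfl⟩ := Nat.exists_eq_add_of_le ha'
  have hu' : (1 / 2 : ℚ) ^ (a₀ + a₁ + 2) ≤ (1 / 2 : ℚ) ^ u :=
    pow_le_pow_of_le_one (by norm_num) (by norm_num) (by omega)
  have hx1 : (1 / 2 : ℚ) ^ a₀ ≤ 1 := pow_le_one₀ (by norm_num) (by norm_num)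
  have hy1 : (1 / 2 : ℚ) ^ a₁ ≤ 1 := pow_le_one₀ (by norm_num) (by norm_num)
  have hx0 : 0 ≤ (1 / 2 : ℚ) ^ a₀ := by positivity
  have e1 : (1 / 2 : ℚ) ^ (2 + a₀) = (1 / 2 : ℚ) ^ a₀ * (1 / 4) := by rw [add_comm, pow_add]; norm_num
  have e2 : (1 / 2 : ℚ) ^ (1 + a₁ + 1) = (1 / 2 : ℚ) ^ a₁ * (1 / 4) := by
    rw [show 1 + a₁ + 1 = a₁ + 2 by omega, pow_add]; norm_num
  have e3 : (1 / 2 : ℚ) ^ (a₀ + a₁ + 2) = (1 / 2 : ℚ) ^ a₀ * (1 / 2 : ℚ) ^ a₁ * (1 / 4) := by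
    rw [pow_add, pow_add]; norm_num
  rw [e1, e2]
  rw [e3] at hu'
  nlinarith [mul_nonneg (sub_nonneg.2 hx1) (sub_nonneg.2 hy1)]

/-- CONJECTURE E♭ AT CORANK ONE (every rank): `B` subset-sum distinct for `h`, `p ∉ B`, `h` zero-sum free on `S = B ∪ {p}` and `τ`
H-good on `S` ⟹ `E(τ; S) ≤ 1/2 + 2^{-ρ} - 2^{ρ-1-c}`. -/
theorem soloBlind_eflat_corank_one [Module (ZMod 3) G] {h : ι → G} {B : Finset ι} {p : ι} (hpB : p ∉ B)
    (hdist : ∀ A ⊆ B, ∀ A' ⊆ B, ∑ i ∈ A, h i = ∑ i ∈ A', h i → A = A')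
    (zsf : ∀ T ⊆ insert p B, T.Nonempty → ∑ i ∈ T, h i ≠ 0) {τ : G}
    (hgood : ∀ T ⊆ insert p B, ∑ i ∈ T, h i ≠ τ + τ) :
    soloBlindEFlatAt h (insert p B) τ := by
  classical
  rcases soloBlind_corankOne_reps hpB hdist τ with hle | ⟨A, A', hAB, hA'B, hAs, hA's, hrep⟩
  · exact soloBlind_eflat_of_card_le_one hle
  have hpA : p ∉ A := fun hp => hpB (hAB hp)
  have hpA' : p ∉ A' := fun hp => hpB (hA'B hp)
  have hne : A ≠ insert p A' := fun e => hpA (by rw [e]; exact Finset.mem_insert_self p A')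
  -- zero-sum freeness: `A ⊄ A'`
  have hnot : ¬ A ⊆ A' := by
    intro hsub
    apply zsf (insert p (A' \ A)) (Finset.insert_subset_insert p (Finset.sdiff_subset.trans hA'B))
      (Finset.insert_nonempty p _)
    rw [Finset.sum_insert (fun hp => hpA' (Finset.mem_sdiff.1 hp).1), Finset.sum_sdiff_eq_sub hsub, hAs, hA's]
    abel
  -- H-goodness: `A ∩ A' ≠ ∅`
  have hinter : (A ∩ A').Nonempty := by
    by_contra hdis
    rw [Finset.not_nonempty_iff_eq_empty, ← Finset.disjoint_iff_inter_eq_empty] at hdis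
    apply hgood (A ∪ insert p A')
      (Finset.union_subset (hAB.trans (Finset.subset_insert p B)) (Finset.insert_subset_insert p hA'B))
    have hdis' : Disjoint A (insert p A') :=
      Finset.disjoint_insert_right.2 ⟨hpA, hdis⟩
    rw [Finset.sum_union hdis', Finset.sum_insert hpA', hAs, hA's]
    abel
  obtain ⟨x, hx⟩ := hinter
  rw [Finset.mem_inter] at hx
  have ha' : 1 ≤ A'.card := Finset.card_pos.2 ⟨x, hx.2⟩
  have ha : 2 ≤ A.card := by
    by_contra hlt
    have hA1 : A.card ≤ 1 := by omega
    apply hnot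
    intro y hy
    rw [Finset.card_le_one.1 hA1 y hy x hx.1]
    exact hx.2
  have hu : (A ∪ A').card + 1 ≤ A.card + A'.card := by
    have e := Finset.card_union_add_card_inter A A'
    have hi : 1 ≤ (A ∩ A').card := Finset.card_pos.2 ⟨x, Finset.mem_inter.2 hx⟩
    omega
  -- mass, core, core size, core rank (as in the K♭ file)
  have hmass : soloBlindMass h (insert p B) τ = (1 / 2 : ℚ) ^ A.card + (1 / 2 : ℚ) ^ (A'.card + 1) := by
    rw [soloBlindMass, hrep, Finset.sum_pair hne, Finset.card_insert_of_notMem hpA']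
  have hcore : soloBlindCore h (insert p B) τ = insert p (A ∪ A') := by
    rw [soloBlindCore, hrep, Finset.biUnion_insert, Finset.singleton_biUnion, id, id, Finset.union_insert]
  have hpU : p ∉ A ∪ A' := fun hp => by
    rcases Finset.mem_union.1 hp with hp | hp
    · exact hpA hp
    · exact hpA' hp
  have hcard : (soloBlindCore h (insert p B) τ).card = (A ∪ A').card + 1 := by
    rw [hcore, Finset.card_insert_of_notMem hpU]
  have hrank : soloBlindCoreRank h (insert p B) τ ≤ (A ∪ A').card := by
    unfold soloBlindCoreRank
    rw [hcore]
    have hp_span : h p ∈ Submodule.span (ZMod 3) (↑((A ∪ A').image h) : Set G) := by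
      have e : h p = ∑ i ∈ A, h i - ∑ i ∈ A', h i := by rw [hAs, hA's]; abel
      rw [e]
      refine Submodule.sub_mem _ (Submodule.sum_mem _ fun i hi => Submodule.subset_span ?_)
        (Submodule.sum_mem _ fun i hi => Submodule.subset_span ?_)
      · rw [Finset.coe_image]; exact ⟨i, Finset.mem_coe.2 (Finset.mem_union_left _ hi), rfl⟩
      · rw [Finset.coe_image]; exact ⟨i, Finset.mem_coe.2 (Finset.mem_union_right _ hi), rfl⟩
    have h1 : Submodule.span (ZMod 3) (h '' (↑(insert p (A ∪ A')) : Set ι))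
        ≤ Submodule.span (ZMod 3) (↑((A ∪ A').image h) : Set G) := by
      refine Submodule.span_le.2 ?_
      rintro v ⟨y, hy, rfl⟩
      rw [Finset.mem_coe, Finset.mem_insert] at hy
      rcases hy with rfl | hy
      · exact hp_span
      · refine Submodule.subset_span ?_
        rw [Finset.coe_image]
        exact ⟨y, Finset.mem_coe.2 hy, rfl⟩
    calc Module.finrank (ZMod 3) (Submodule.span (ZMod 3) (h '' (↑(insert p (A ∪ A')) : Set ι)))
        ≤ Module.finrank (ZMod 3) (Submodule.span (ZMod 3) (↑((A ∪ A').image h) : Set G)) :=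
          Submodule.finrank_mono h1
      _ ≤ ((A ∪ A').image h).card := finrank_span_finset_le_card _
      _ ≤ (A ∪ A').card := Finset.card_image_le
  -- assemble
  unfold soloBlindEFlatAt
  rw [hmass, hcard]
  calc (1 / 2 : ℚ) ^ A.card + (1 / 2 : ℚ) ^ (A'.card + 1)
      ≤ 1 / 4 + (1 / 2 : ℚ) ^ (A ∪ A').card := soloBlind_twoRep_ineq_E ha ha' hu
    _ = soloBlindEFlatBound (A ∪ A').card ((A ∪ A').card + 1) := by
        unfold soloBlindEFlatBound
        rw [show (A ∪ A').card + 1 + 1 - (A ∪ A').card = 2 by omega]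
        ring
    _ ≤ soloBlindEFlatBound (soloBlindCoreRank h (insert p B) τ) ((A ∪ A').card + 1) :=
        soloBlind_eflatBound_anti hrank (by omega)

end Summit.MatrixMultiplication.MatrixMultiplication.Theorems
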